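import Summits.QuantumFields.YangMills.Theorems.PencilRigidityWeakCouplingHypercubicLimitOfRpCoreDisjoint
import Summits.QuantumFields.YangMills.Theorems.PencilRigidityWeakCouplingHypercubicLimitRPOfOneFieldRP
import HarnessLib

/-!
# The FOLD crux `WeakCouplingHypercubicLimitRP` (stmt-QuantumFields-27398) from its two open stubs: D1 and the disjoint RP core

Helper file for line `Sketch` of crux stmt-QuantumFields-27398 (`PencilRigidity.WeakCouplingHypercubicLimitRP`; FOLD shape F,
director-ym O4 WORD 1–2, 2026-08-31), §12 of the re-registered skeleton (`Cruxes/WeakCouplingHypercubicLimitRP/Lines/Sketch.lean`).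
The skeleton is the registered line of the aside crux stmt-16120 VERBATIM (heart S6i `stub_rpCoreDisjoint` = the DISJOINT RP CORE,
landed closure `weakCouplingHypercubicLimit_of_rpCoreDisjoint`, p149207) plus ONE new stub D1 `stub_diagRPOfPlaneLimits` (diagonal-frame
reflection positivity of the constructed plane-limit family `planeSum T` along the subsequence `φ`).  This file certifies everything of the
new composition EXCEPT the two stubs, which enter as hypotheses stated VERBATIM as registered:

* `oneFieldClausesRP_of_ufbDisjointCore_of_diagRP` — D1 ⟹ (the landed `oneFieldClauses_of_ufbDisjointCore` with the extra output
  `DiagonalFrameRP S₁`; proof verbatim, the extra output read off D1 at the constructed `(φ, T)`);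
* `weakCouplingHypercubicLimitRP_of_diagRP_of_rpCoreDisjoint` — D1 ⟹ disjoint RP core ⟹ `PencilRigidity.WeakCouplingHypercubicLimitRP`
  (lattice gap at half the RP-spectral rate, rate realigned, order-one bound from UFB, the lemma above, the landed packaging
  `weakCouplingHypercubicLimitRP_of_oneFieldRP`); and `…_mmb_…` for the MirrorModularBoosts / IsotropyFromPowerCounting twin stmt-27395.

HONEST LABEL: glue only — the two hypotheses ARE the open content (S6i: the Clay existence-and-gap construction in lattice terms; D1: the
45°-universality of the weak-coupling limit); nothing here proves them; the Yang–Mills mass gap is NOT proved.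
Refs: OsterwalderSchrader1973 §2–3; OsterwalderSeiler1978 §2; GlimmJaffe1987 §6.1, §19.7.
-/

noncomputable section

open scoped SchwartzMap
open MeasureTheory Filter Topology
open Literature.MathematicalPhysics.AQFT Literature.MathematicalPhysics.QuantumLattice
open Literature.MathematicalPhysics.QuantumFieldTheory

namespace Summit.QuantumFields.YangMills.Theorems.WeakCouplingHypercubicLimit.TraceNormColdPressure

open Summit.QuantumFields.YangMills.Cruxes.HypercubicLimit.CouplingResponse
open Summit.QuantumFields.YangMills.Cruxes.OSLegsFromFemtoAndGap.DlrCollarTransfer (conn Decay RPPos ConnCS)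
open Summit.QuantumFields.YangMills.Cruxes.DiagonalMirrorRPR.ParityBridgeColdTraces (DiagonalFrameRP)

/-- **The UFB disjoint core gives a weak-coupling one-field witness WITH diagonal-frame RP, GIVEN D1** (FOLD, r18): the LANDED
`oneFieldClauses_of_ufbDisjointCore` (`Theorems/PencilRigidityWeakCouplingHypercubicLimitOfRpCoreDisjoint.lean`, p149207) re-proved VERBATIM
with the extra output `DiagonalFrameRP S₁` supplied by the hypothesis `hD1` = the registered statement of the line's ONE new stub D1
`stub_diagRPOfPlaneLimits` (diagonal-frame RP of the constructed plane-limit family), applied at the constructed `(φ, T)` — which the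
landed statement hides behind `∃ sch' S₁`, so the output cannot be bolted on from outside.
Bounded counterterms from the order-one bound and the `κ₃` floor; compactness along a subsequence (`stub_planeLimits`); E0/E0′/E3,
translations, convergence; `RPPos`, `W(B₄)`, decay ⇒ `ReflHalf`; `ConnCS`; the `κ₃` floor passed to the limit in pairwise-disjoint
geometry (N1) and time-separated by symmetry (N2a–N3b) before non-triviality; `SoftHalf`; `oneFieldClauses_of_halves`. [folklore] -/
theorem oneFieldClausesRP_of_ufbDisjointCore_of_diagRP
    (hD1 : ∀ (G : Type) [Group G] [TopologicalSpace G] [IsTopologicalGroup G] [CompactSpace G]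
      [MeasurableSpace G] [BorelSpace G] (r : LatticeRep G) (sch : SpeciesScheme (YMSpecies G))
      (φ : ℕ → ℕ) (hφ : StrictMono φ)
      (T : (n : ℕ) → (Fin n → Plane) → (𝓢((Fin n → EuclideanSpace ℝ (Fin 4)), ℂ) →L[ℂ] ℂ)),
      sch.HasWeakCouplingLimit → PolyVolume sch → PolyRenorm r sch → UniformFunctionalBoundPlanes r sch →
        (∃ Δ C : ℝ, 0 < Δ ∧ RPSpectral r sch Δ C) → PlaneLimits r sch φ T → DiagonalFrameRP (planeSum T))
    {G : Type} [Group G] [TopologicalSpace G] [IsTopologicalGroup G] [CompactSpace G] [MeasurableSpace G] [BorelSpace G]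
    (r : LatticeRep G) (sch : SpeciesScheme (YMSpecies G))
    (hw : sch.HasWeakCouplingLimit) (hpv : PolyVolume sch) (hpr : PolyRenorm r sch) (hUFB : UniformFunctionalBoundPlanes r sch)
    (hM1 : ∃ (s : ℕ) (C : ℝ), ∀ F : Plane → 𝓢(EuclideanSpace ℝ (Fin 4), ℝ), normP s F ≤ 1 →
      ∀ k : ℕ, |∫ U, fieldP r sch k F U ∂(wilsonAt r sch k)| ≤ C)
    {Δ C : ℝ} (hΔ : 0 < Δ) (hgap : HasLatticeMassGap r sch Δ) (hrp : RPSpectral r sch Δ C)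
    (hNG : ∃ (f g h : 𝓢(EuclideanSpace ℝ (Fin 4), ℝ)) (δ : ℝ),
        Disjoint (tsupport f) (tsupport g) ∧ Disjoint (tsupport f) (tsupport h) ∧
        Disjoint (tsupport g) (tsupport h) ∧ 0 < δ ∧
        ∀ᶠ k in atTop, δ ≤
          |latticeSchwinger r.ρ sch (fun s => s.F) k 3 (fun _ => r.curvature) ![f, g, h] -
            latticeSchwinger r.ρ sch (fun s => s.F) k 1 (fun _ => r.curvature) ![f] *
              latticeSchwinger r.ρ sch (fun s => s.F) k 2 (fun _ => r.curvature) ![g, h] -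
            latticeSchwinger r.ρ sch (fun s => s.F) k 1 (fun _ => r.curvature) ![g] *
              latticeSchwinger r.ρ sch (fun s => s.F) k 2 (fun _ => r.curvature) ![f, h] -
            latticeSchwinger r.ρ sch (fun s => s.F) k 1 (fun _ => r.curvature) ![h] *
              latticeSchwinger r.ρ sch (fun s => s.F) k 2 (fun _ => r.curvature) ![f, g] +
            2 * (latticeSchwinger r.ρ sch (fun s => s.F) k 1 (fun _ => r.curvature) ![f] *
              latticeSchwinger r.ρ sch (fun s => s.F) k 1 (fun _ => r.curvature) ![g] *
              latticeSchwinger r.ρ sch (fun s => s.F) k 1 (fun _ => r.curvature) ![h])|) :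
    ∃ (sch' : SpeciesScheme (YMSpecies G)) (S₁ : SchwingerFamily (EuclideanSpace ℝ (Fin 4))),
      sch'.HasWeakCouplingLimit ∧ OneFieldClauses r sch' S₁ ∧ DiagonalFrameRP S₁ := by
  -- bounded counterterms from the order-one bound and the κ₃ floor
  have hbm : ∃ Cm : ℝ, ∀ k, |sch.m r.curvature k| ≤ Cm := by
    obtain ⟨f, g, h, δ, -, -, -, hδ, hev⟩ := hNG
    exact countertermBound_of_momentOne_skewFloor G r sch hM1 ⟨f, g, h, δ, hδ, hev⟩
  -- compactness along a subsequence
  obtain ⟨φ, hφ, T, hPL⟩ := stub_planeLimits G r sch hUFB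
  have hβ0 : ∀ᶠ k in atTop, 0 ≤ sch.β k := hw.eventually_ge_atTop 0
  -- soft facts
  obtain ⟨hE0, hE3⟩ := planeSum_isNormalized_isSymmetric G r sch φ T hPL
  have hE0' := planeSum_hasLinearGrowth G r sch φ T hPL
  have htr := stub_translationPlanesMono G r sch φ hφ T hpv hpr hUFB hPL
  have hconv := convergence_subseq_of_planeLimits G r sch φ hφ T hPL
  -- reflection facts (axis frames: R3′, `W(B₄)`: R3, decay: R6′) and the NEW diagonal-frame RP (D1)
  have hRP : RPPos (planeSum T) := stub_rpPosOfPlaneLimits G r sch φ hφ T hβ0 hUFB hPL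
  have hSP := stub_signedPermOfPlaneLimits G r sch φ hφ T hUFB hPL
  have hD : Decay (planeSum T) Δ := stub_decayOfRPSpectral G r sch φ hφ T Δ C hΔ hpv hpr hbm hUFB hPL hrp
  have hdiag : DiagonalFrameRP (planeSum T) :=
    hD1 G r sch φ hφ T hw hpv hpr hUFB ⟨Δ, C, hΔ, hrp⟩ hPL
  have hrefl : ReflHalf (planeSum T) Δ :=
    reflHalf_of_pieces (planeSum T) hΔ hE0 (fun n _ a F hF => htr n a F hF) hRP hSP hD
  -- `ConnCS` of the limit
  have hN' : ∀ F : 𝓢((Fin 0 → EuclideanSpace ℝ (Fin 4)), ℂ), planeSum T 0 F = F default := fun F =>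
    (hE0 (fun _ => ()) F).trans (congrArg F (Subsingleton.elim _ _))
  have htrans' : ∀ (n : ℕ) (t : EuclideanSpace ℝ (Fin 4)) (F : 𝓢((Fin n → EuclideanSpace ℝ (Fin 4)), ℂ)), IsOffDiagonal F →
      planeSum T n (translateMulti t F) = planeSum T n F := fun n t F hF => htr n t F hF
  obtain ⟨hCS, -⟩ :=
    _root_.Summit.QuantumFields.YangMills.Cruxes.OSLegsFromFemtoAndGap.DlrCollarTransfer.stub_gap (planeSum T) hN' htrans' hRP
  -- the κ₃ floor along the subsequence, its continuum PAIRWISE-DISJOINT datum, time separation by symmetry, non-triviality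
  have hNG' : ∃ (f g h : 𝓢(EuclideanSpace ℝ (Fin 4), ℝ)) (δ : ℝ),
      Disjoint (tsupport f) (tsupport g) ∧ Disjoint (tsupport f) (tsupport h) ∧
      Disjoint (tsupport g) (tsupport h) ∧ 0 < δ ∧
      ∀ᶠ k in atTop, δ ≤
        |latticeSchwinger r.ρ (subseq sch φ hφ) (fun s => s.F) k 3 (fun _ => r.curvature) ![f, g, h] -
          latticeSchwinger r.ρ (subseq sch φ hφ) (fun s => s.F) k 1 (fun _ => r.curvature) ![f] *
            latticeSchwinger r.ρ (subseq sch φ hφ) (fun s => s.F) k 2 (fun _ => r.curvature) ![g, h] -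
          latticeSchwinger r.ρ (subseq sch φ hφ) (fun s => s.F) k 1 (fun _ => r.curvature) ![g] *
            latticeSchwinger r.ρ (subseq sch φ hφ) (fun s => s.F) k 2 (fun _ => r.curvature) ![f, h] -
          latticeSchwinger r.ρ (subseq sch φ hφ) (fun s => s.F) k 1 (fun _ => r.curvature) ![h] *
            latticeSchwinger r.ρ (subseq sch φ hφ) (fun s => s.F) k 2 (fun _ => r.curvature) ![f, g] +
          2 * (latticeSchwinger r.ρ (subseq sch φ hφ) (fun s => s.F) k 1 (fun _ => r.curvature) ![f] *
            latticeSchwinger r.ρ (subseq sch φ hφ) (fun s => s.F) k 1 (fun _ => r.curvature) ![g] *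
            latticeSchwinger r.ρ (subseq sch φ hφ) (fun s => s.F) k 1 (fun _ => r.curvature) ![h])| := by
    obtain ⟨f, g, h, δ, hfg, hfh, hgh, hδ, hev⟩ := hNG
    exact ⟨f, g, h, δ, hfg, hfh, hgh, hδ, eventually_subseq hφ hev⟩
  have hdisj := stub_disjointOfLatticeFloor G r (subseq sch φ hφ) (planeSum T) hconv hNG'
  have hE3' : ∀ (n : ℕ) (π : Equiv.Perm (Fin n)) (F : 𝓢((Fin n → EuclideanSpace ℝ (Fin 4)), ℂ)), IsOffDiagonal F →
      planeSum T n (permTest π F) = planeSum T n F := fun n π F hF => hE3 n (fun _ => ()) π F hF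
  have hsep := skewSepDatum_of_disjointDatum (planeSum T) hE3' htrans' hSP hdisj
  have hNT := stub_ntOfSkewSeparated (planeSum T) hCS hsep
  have hNGc : ∃ (f g h : 𝓢(EuclideanSpace ℝ (Fin 4), ℂ)) (Ffgh : 𝓢((Fin 3 → EuclideanSpace ℝ (Fin 4)), ℂ))
      (Fgh Ffh Ffg : 𝓢((Fin 2 → EuclideanSpace ℝ (Fin 4)), ℂ)) (Ff Fg Fh : 𝓢((Fin 1 → EuclideanSpace ℝ (Fin 4)), ℂ)),
      IsTensorOf Ffgh ![f, g, h] ∧ IsOffDiagonal Ffgh ∧ IsTensorOf Fgh ![g, h] ∧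
      IsTensorOf Ffh ![f, h] ∧ IsTensorOf Ffg ![f, g] ∧ IsTensorOf Ff ![f] ∧ IsTensorOf Fg ![g] ∧ IsTensorOf Fh ![h] ∧
      (planeSum T).toLabelled 3 (fun _ => ()) Ffgh -
          (planeSum T).toLabelled 1 (fun _ => ()) Ff * (planeSum T).toLabelled 2 (fun _ => ()) Fgh -
        (planeSum T).toLabelled 1 (fun _ => ()) Fg * (planeSum T).toLabelled 2 (fun _ => ()) Ffh -
        (planeSum T).toLabelled 1 (fun _ => ()) Fh * (planeSum T).toLabelled 2 (fun _ => ()) Ffg +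
        2 * ((planeSum T).toLabelled 1 (fun _ => ()) Ff * (planeSum T).toLabelled 1 (fun _ => ()) Fg *
          (planeSum T).toLabelled 1 (fun _ => ()) Fh) ≠ 0 := by
    obtain ⟨f, g, h, Ffgh, Fgh, Ffh, Ffg, Ff, Fg, Fh, -, -, -, -, h1, h2, h3, h4, h5, h6, h7, h8, h9⟩ := hsep
    exact ⟨f, g, h, Ffgh, Fgh, Ffh, Ffg, Ff, Fg, Fh, h1, h2, h3, h4, h5, h6, h7, h8, h9⟩
  -- assemble the soft half and conclude (weak coupling and the lattice gap restrict to the subsequence)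
  have hsoft : SoftHalf r (subseq sch φ hφ) (planeSum T) Δ :=
    ⟨hE0, hE0', hE3, fun n _ a F hF => htr n a F hF, hconv, hNT, hNGc, hasLatticeMassGap_subseq r sch φ hφ hgap⟩
  exact ⟨subseq sch φ hφ, planeSum T, hasWeakCouplingLimit_subseq sch φ hφ hw,
    oneFieldClauses_of_halves r _ _ hΔ hsoft hrefl, hdiag⟩

/-- **The FOLD crux from the SAME DISJOINT RP CORE as `weakCouplingHypercubicLimit_of_rpCoreDisjoint`** (core = the statement of the
registered heart S6i `stub_rpCoreDisjoint`, verbatim): weak coupling ∧ `PolyVolume` ∧ `PolyRenorm` ∧ `UniformFunctionalBoundPlanes` ∧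
(∃ Δ C, 0 < Δ ∧ `RPSpectral r sch Δ C`) ∧ ONE `κ₃` floor on SOME pairwise-disjoint real triple ⇒ `PencilRigidity.WeakCouplingHypercubicLimitRP`.
Lattice gap at half the RP-spectral rate (K5 `stub_gapOfRPSpectral`), rate realigned (K1 `stub_rpSpectralAnti`), order-one bound from UFB
(`momentOne_of_ufb`), then `oneFieldClausesRP_of_ufbDisjointCore_of_diagRP` and the landed packaging `weakCouplingHypercubicLimitRP_of_oneFieldRP`.  So the
registered skeleton's top composition is `weakCouplingHypercubicLimitRP_of_diagRP_of_rpCoreDisjoint stub_diagRPOfPlaneLimits stub_rpCoreDisjoint`: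
the crux BY NAME from its two open stubs D1 and S6i, everything else kernel-certified here. [folklore] -/
theorem weakCouplingHypercubicLimitRP_of_diagRP_of_rpCoreDisjoint
    (hD1 : ∀ (G : Type) [Group G] [TopologicalSpace G] [IsTopologicalGroup G] [CompactSpace G]
      [MeasurableSpace G] [BorelSpace G] (r : LatticeRep G) (sch : SpeciesScheme (YMSpecies G))
      (φ : ℕ → ℕ) (hφ : StrictMono φ)
      (T : (n : ℕ) → (Fin n → Plane) → (𝓢((Fin n → EuclideanSpace ℝ (Fin 4)), ℂ) →L[ℂ] ℂ)),
      sch.HasWeakCouplingLimit → PolyVolume sch → PolyRenorm r sch → UniformFunctionalBoundPlanes r sch →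
        (∃ Δ C : ℝ, 0 < Δ ∧ RPSpectral r sch Δ C) → PlaneLimits r sch φ T → DiagonalFrameRP (planeSum T))
    (hcore : ∀ (G : Type) [Group G] [TopologicalSpace G] [IsTopologicalGroup G] [CompactSpace G]
      [MeasurableSpace G] [BorelSpace G], IsCompactSimpleLieGroup G →
      ∃ (r : LatticeRep G) (sch : SpeciesScheme (YMSpecies G)),
        sch.HasWeakCouplingLimit ∧ PolyVolume sch ∧ PolyRenorm r sch ∧ UniformFunctionalBoundPlanes r sch ∧
        (∃ Δ C : ℝ, 0 < Δ ∧ RPSpectral r sch Δ C) ∧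
        (∃ (f g h : 𝓢(EuclideanSpace ℝ (Fin 4), ℝ)) (δ : ℝ),
          Disjoint (tsupport f) (tsupport g) ∧ Disjoint (tsupport f) (tsupport h) ∧
          Disjoint (tsupport g) (tsupport h) ∧ 0 < δ ∧
          ∀ᶠ k in atTop, δ ≤
            |latticeSchwinger r.ρ sch (fun s => s.F) k 3 (fun _ => r.curvature) ![f, g, h] -
              latticeSchwinger r.ρ sch (fun s => s.F) k 1 (fun _ => r.curvature) ![f] *
                latticeSchwinger r.ρ sch (fun s => s.F) k 2 (fun _ => r.curvature) ![g, h] -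
              latticeSchwinger r.ρ sch (fun s => s.F) k 1 (fun _ => r.curvature) ![g] *
                latticeSchwinger r.ρ sch (fun s => s.F) k 2 (fun _ => r.curvature) ![f, h] -
              latticeSchwinger r.ρ sch (fun s => s.F) k 1 (fun _ => r.curvature) ![h] *
                latticeSchwinger r.ρ sch (fun s => s.F) k 2 (fun _ => r.curvature) ![f, g] +
              2 * (latticeSchwinger r.ρ sch (fun s => s.F) k 1 (fun _ => r.curvature) ![f] *
                latticeSchwinger r.ρ sch (fun s => s.F) k 1 (fun _ => r.curvature) ![g] *
                latticeSchwinger r.ρ sch (fun s => s.F) k 1 (fun _ => r.curvature) ![h])|)) :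
    Summit.QuantumFields.YangMills.Theses.PencilRigidity.WeakCouplingHypercubicLimitRP := by
  refine weakCouplingHypercubicLimitRP_of_oneFieldRP fun G _ _ _ _ hG => ?_
  letI : MeasurableSpace G := borel G
  haveI : BorelSpace G := ⟨rfl⟩
  obtain ⟨r, sch, hw, hpv, hpr, hUFB, ⟨Δ, C, hΔ, hRP⟩, hNG⟩ := hcore G hG
  have hgap : HasLatticeMassGap r sch (Δ / 2) :=
    stub_gapOfRPSpectral G r sch Δ C hΔ (Filter.tendsto_atTop.1 hw 0) hRP
  have hrp : RPSpectral r sch (Δ / 2) (2 * max C 0) :=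
    stub_rpSpectralAnti G r sch Δ (Δ / 2) C (by linarith) (by linarith) hRP
  obtain ⟨sch', S₁, hw', h₁, hdiag⟩ :=
    oneFieldClausesRP_of_ufbDisjointCore_of_diagRP hD1 r sch hw hpv hpr hUFB (momentOne_of_ufb G r sch hUFB) (half_pos hΔ) hgap hrp hNG
  exact ⟨r, sch', S₁, hw', h₁, hdiag⟩

/-- The MirrorModularBoosts / IsotropyFromPowerCounting twin stmt-QuantumFields-27395 from the same two hypotheses. [folklore] -/
theorem weakCouplingHypercubicLimitRP_mmb_of_diagRP_of_rpCoreDisjoint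
    (hD1 : ∀ (G : Type) [Group G] [TopologicalSpace G] [IsTopologicalGroup G] [CompactSpace G]
      [MeasurableSpace G] [BorelSpace G] (r : LatticeRep G) (sch : SpeciesScheme (YMSpecies G))
      (φ : ℕ → ℕ) (hφ : StrictMono φ)
      (T : (n : ℕ) → (Fin n → Plane) → (𝓢((Fin n → EuclideanSpace ℝ (Fin 4)), ℂ) →L[ℂ] ℂ)),
      sch.HasWeakCouplingLimit → PolyVolume sch → PolyRenorm r sch → UniformFunctionalBoundPlanes r sch →
        (∃ Δ C : ℝ, 0 < Δ ∧ RPSpectral r sch Δ C) → PlaneLimits r sch φ T → DiagonalFrameRP (planeSum T))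
    (hcore : ∀ (G : Type) [Group G] [TopologicalSpace G] [IsTopologicalGroup G] [CompactSpace G]
      [MeasurableSpace G] [BorelSpace G], IsCompactSimpleLieGroup G →
      ∃ (r : LatticeRep G) (sch : SpeciesScheme (YMSpecies G)),
        sch.HasWeakCouplingLimit ∧ PolyVolume sch ∧ PolyRenorm r sch ∧ UniformFunctionalBoundPlanes r sch ∧
        (∃ Δ C : ℝ, 0 < Δ ∧ RPSpectral r sch Δ C) ∧
        (∃ (f g h : 𝓢(EuclideanSpace ℝ (Fin 4), ℝ)) (δ : ℝ),
          Disjoint (tsupport f) (tsupport g) ∧ Disjoint (tsupport f) (tsupport h) ∧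
          Disjoint (tsupport g) (tsupport h) ∧ 0 < δ ∧
          ∀ᶠ k in atTop, δ ≤
            |latticeSchwinger r.ρ sch (fun s => s.F) k 3 (fun _ => r.curvature) ![f, g, h] -
              latticeSchwinger r.ρ sch (fun s => s.F) k 1 (fun _ => r.curvature) ![f] *
                latticeSchwinger r.ρ sch (fun s => s.F) k 2 (fun _ => r.curvature) ![g, h] -
              latticeSchwinger r.ρ sch (fun s => s.F) k 1 (fun _ => r.curvature) ![g] *
                latticeSchwinger r.ρ sch (fun s => s.F) k 2 (fun _ => r.curvature) ![f, h] -
              latticeSchwinger r.ρ sch (fun s => s.F) k 1 (fun _ => r.curvature) ![h] *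
                latticeSchwinger r.ρ sch (fun s => s.F) k 2 (fun _ => r.curvature) ![f, g] +
              2 * (latticeSchwinger r.ρ sch (fun s => s.F) k 1 (fun _ => r.curvature) ![f] *
                latticeSchwinger r.ρ sch (fun s => s.F) k 1 (fun _ => r.curvature) ![g] *
                latticeSchwinger r.ρ sch (fun s => s.F) k 1 (fun _ => r.curvature) ![h])|)) :
    Summit.QuantumFields.YangMills.Theses.MirrorModularBoosts.WeakCouplingHypercubicLimitRP :=
  weakCouplingHypercubicLimitRP_mmb_of_pr (weakCouplingHypercubicLimitRP_of_diagRP_of_rpCoreDisjoint hD1 hcore)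

end Summit.QuantumFields.YangMills.Theorems.WeakCouplingHypercubicLimit.TraceNormColdPressure

end
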